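import Summits.BirchSwinnertonDyer.BirchSwinnertonDyer.Theses.KimAtThreeKolyvagin
import HarnessLib

/-! # BC3 birth skeleton — crux `KimAtThreeKolyvagin.KatoKuriharaPortThreeShared` (stmt-BirchSwinnertonDyer-19560)
Planner bsd-addord-plan g15.  PORT″ (`KatoKuriharaPortThreeAtWith₂ W 0 v₃ η P`) asks, for two depths
`k ≤ k′` and canonical data `D, D′` for the SAME generator family `η`, witness triples `(κ, Λ, κ′)` at
depth `k` and `(κ⁺, Λ⁺, κ′⁺)` at depth `k′` with the REDUCTION COMPATIBILITY (COMP).  Seam: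
`stub_oneLevel` = Kim 2022 Thm 3.13 at ONE depth (Kato's Euler system ↦ a Kolyvagin system for
`E[3^{k′+1}]` with `𝓕_can`, realising the Kurihara numbers through `Λ = exp*_ω` at `v₃` — FLAG
`K22-Thm3.13-PORT@3`, one level only) and `stub_descend` = ONE EULER SYSTEM (the depth-`k′` witness for
`D′` descends along `red = 3^{k′−k}·` to a depth-`k` witness for `D` with `red_* κ⁺_d = κ_d`,
`red_* κ′⁺_d = κ′_d` on common levels: MR04 Def 3.1.3 / App. A (33) functoriality + Kato's classes being
norm-compatible).  `KatoKuriharaPortThreeShared_of` is the kernel-checked assembly; sorries ONLY in the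
two stubs. -/

set_option autoImplicit false

noncomputable section

namespace Summit.BirchSwinnertonDyer.BirchSwinnertonDyer.Cruxes.KatoKuriharaPortThreeShared.Birth

open scoped Classical NumberField ContRepresentation
open Field NumberField IsDedekindDomain WeierstrassCurve
  Literature.NumberTheory.EllipticCurves Literature.NumberTheory.EllipticCurves.ModularForms
  Literature.NumberTheory.EllipticCurves.Rank1Residual
  Literature.NumberTheory.GaloisRepresentations
  Literature.NumberTheory.GaloisRepresentations.DiscreteGaloisModule Literature.NumberTheory.GaloisCohomology
  Summit.BirchSwinnertonDyer.Rank1Residual.GaloisImage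

/-- stub 1 — the ONE-LEVEL port (Kim 2022 Thm 3.13 at a single depth `k′`, on the Kato stratum, at
the lattice-optimal datum of conductor level). -/
theorem stub_oneLevel :
    ∀ (W : WeierstrassCurve ℚ) [W.IsElliptic] [W.IsGloballyMinimal],
      (∀ m : ℕ, W.HasSurjectiveModNGaloisRep (3 ^ m : ℕ)) →
      (haveI : Fact (Nat.Prime 3) := ⟨Nat.prime_three⟩; Addv W 3) →
      ¬ 3 ∣ (W.baseChange ℚ_[3]).localTamagawaNumber ℤ_[3] →
      Nat.card {Q : (W.baseChange ℚ_[3]).toAffine.Point // (3 : ℕ) • Q = 0} = 1 →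
      ∀ (v₃ : HeightOneSpectrum (𝓞 ℚ)), ((3 : ℕ) : 𝓞 ℚ) ∈ v₃.asIdeal →
      ∀ (η : (q : HeightOneSpectrum (𝓞 ℚ)) → (ZMod (Ideal.absNorm q.asIdeal))ˣ),
        (∀ q, Subgroup.zpowers (η q) = ⊤) →
      ∀ {N : ℕ} [NeZero N] (P : ModularParametrizationData W N), N = W.conductorNorm ℤ →
        (∀ z ∈ P.L.lattice, ∃ w ∈ periodLattice P.f, z = P.c * w) →
        ¬ (3 : ℤ) ∣ P.maninConstant →
        (∃ u : ℚ, ‖(u : ℚ_[3])‖ = 1 ∧ W.realPeriodRat = u * plusPeriod P.f) →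
      ∀ (k' : ℕ) (D' : KolyvaginDatum (W.torsionGaloisModule (((3 : ℕ) : ℤ) ^ k' * ((3 : ℕ) : ℤ)))),
        D'.IsCanonicalTauDatumThreeAtWith W k' k' η →
        ∃ (κu : Finset (HeightOneSpectrum (𝓞 ℚ)) →
              galoisCohomology (W.torsionGaloisModule (((3 : ℕ) : ℤ) ^ k' * ((3 : ℕ) : ℤ))) 1)
          (Λu : galoisCohomology ((W.torsionGaloisModule (((3 : ℕ) : ℤ) ^ k' * ((3 : ℕ) : ℤ))).toLocal
              (Sum.inr v₃)) 1 →+ ZMod (3 ^ (k' + 1)))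
          (κu' : Finset (HeightOneSpectrum (𝓞 ℚ)) →
              galoisCohomology (W.torsionGaloisModule (((3 : ℕ) : ℤ) ^ k' * ((3 : ℕ) : ℤ))) 1),
          KatoKuriharaWitnessAt W k' 0 D' v₃ P κu Λu κu' := by
  sorry

/-- stub 2 — DESCENT along the reduction (one Euler system): a depth-`k′` witness for `D′` yields a
depth-`k` witness for `D` whose families are the reductions of the depth-`k′` ones on common levels. -/
theorem stub_descend :
    ∀ (W : WeierstrassCurve ℚ) [W.IsElliptic] [W.IsGloballyMinimal],
      (∀ m : ℕ, W.HasSurjectiveModNGaloisRep (3 ^ m : ℕ)) →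
      ∀ (v₃ : HeightOneSpectrum (𝓞 ℚ)), ((3 : ℕ) : 𝓞 ℚ) ∈ v₃.asIdeal →
      ∀ (η : (q : HeightOneSpectrum (𝓞 ℚ)) → (ZMod (Ideal.absNorm q.asIdeal))ˣ),
        (∀ q, Subgroup.zpowers (η q) = ⊤) →
      ∀ {N : ℕ} [NeZero N] (P : ModularParametrizationData W N),
      ∀ (k k' : ℕ) (D : KolyvaginDatum (W.torsionGaloisModule (((3 : ℕ) : ℤ) ^ k * ((3 : ℕ) : ℤ))))
        (D' : KolyvaginDatum (W.torsionGaloisModule (((3 : ℕ) : ℤ) ^ k' * ((3 : ℕ) : ℤ))))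
        (red : (W.torsionGaloisModule (((3 : ℕ) : ℤ) ^ k' * ((3 : ℕ) : ℤ))).toContRepresentation →ⁱL
          (W.torsionGaloisModule (((3 : ℕ) : ℤ) ^ k * ((3 : ℕ) : ℤ))).toContRepresentation),
        D.IsCanonicalTauDatumThreeAtWith W k k η → D'.IsCanonicalTauDatumThreeAtWith W k' k' η →
        k ≤ k' →
        (∀ x : geomTorsion W (((3 : ℕ) : ℤ) ^ k' * ((3 : ℕ) : ℤ)),
          ((red x : geomTorsion W (((3 : ℕ) : ℤ) ^ k * ((3 : ℕ) : ℤ))) : geomPoints W) =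
            (((3 : ℕ) : ℤ) ^ (k' - k)) • (x : geomPoints W)) →
        ∀ (κu : Finset (HeightOneSpectrum (𝓞 ℚ)) →
              galoisCohomology (W.torsionGaloisModule (((3 : ℕ) : ℤ) ^ k' * ((3 : ℕ) : ℤ))) 1)
          (Λu : galoisCohomology ((W.torsionGaloisModule (((3 : ℕ) : ℤ) ^ k' * ((3 : ℕ) : ℤ))).toLocal
              (Sum.inr v₃)) 1 →+ ZMod (3 ^ (k' + 1)))
          (κu' : Finset (HeightOneSpectrum (𝓞 ℚ)) →
              galoisCohomology (W.torsionGaloisModule (((3 : ℕ) : ℤ) ^ k' * ((3 : ℕ) : ℤ))) 1),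
          KatoKuriharaWitnessAt W k' 0 D' v₃ P κu Λu κu' →
        ∃ (κ : Finset (HeightOneSpectrum (𝓞 ℚ)) →
              galoisCohomology (W.torsionGaloisModule (((3 : ℕ) : ℤ) ^ k * ((3 : ℕ) : ℤ))) 1)
          (Λ : galoisCohomology ((W.torsionGaloisModule (((3 : ℕ) : ℤ) ^ k * ((3 : ℕ) : ℤ))).toLocal
              (Sum.inr v₃)) 1 →+ ZMod (3 ^ (k + 1)))
          (κ' : Finset (HeightOneSpectrum (𝓞 ℚ)) →
              galoisCohomology (W.torsionGaloisModule (((3 : ℕ) : ℤ) ^ k * ((3 : ℕ) : ℤ))) 1),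
          KatoKuriharaWitnessAt W k 0 D v₃ P κ Λ κ' ∧
          ∀ d, D'.IsLevel d → D.IsLevel d →
            galoisCohomology.map red 1 (κu d) = κ d ∧ galoisCohomology.map red 1 (κu' d) = κ' d := by
  sorry

/-- COMPOSITION (kernel-checked): one-level port + descent ⟹ the shared-generator PORT″ crux BY NAME. -/
theorem KatoKuriharaPortThreeShared_of
    (h₁ : ∀ (W : WeierstrassCurve ℚ) [W.IsElliptic] [W.IsGloballyMinimal],
      (∀ m : ℕ, W.HasSurjectiveModNGaloisRep (3 ^ m : ℕ)) →
      (haveI : Fact (Nat.Prime 3) := ⟨Nat.prime_three⟩; Addv W 3) →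
      ¬ 3 ∣ (W.baseChange ℚ_[3]).localTamagawaNumber ℤ_[3] →
      Nat.card {Q : (W.baseChange ℚ_[3]).toAffine.Point // (3 : ℕ) • Q = 0} = 1 →
      ∀ (v₃ : HeightOneSpectrum (𝓞 ℚ)), ((3 : ℕ) : 𝓞 ℚ) ∈ v₃.asIdeal →
      ∀ (η : (q : HeightOneSpectrum (𝓞 ℚ)) → (ZMod (Ideal.absNorm q.asIdeal))ˣ),
        (∀ q, Subgroup.zpowers (η q) = ⊤) →
      ∀ {N : ℕ} [NeZero N] (P : ModularParametrizationData W N), N = W.conductorNorm ℤ →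
        (∀ z ∈ P.L.lattice, ∃ w ∈ periodLattice P.f, z = P.c * w) →
        ¬ (3 : ℤ) ∣ P.maninConstant →
        (∃ u : ℚ, ‖(u : ℚ_[3])‖ = 1 ∧ W.realPeriodRat = u * plusPeriod P.f) →
      ∀ (k' : ℕ) (D' : KolyvaginDatum (W.torsionGaloisModule (((3 : ℕ) : ℤ) ^ k' * ((3 : ℕ) : ℤ)))),
        D'.IsCanonicalTauDatumThreeAtWith W k' k' η →
        ∃ (κu : Finset (HeightOneSpectrum (𝓞 ℚ)) →
              galoisCohomology (W.torsionGaloisModule (((3 : ℕ) : ℤ) ^ k' * ((3 : ℕ) : ℤ))) 1)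
          (Λu : galoisCohomology ((W.torsionGaloisModule (((3 : ℕ) : ℤ) ^ k' * ((3 : ℕ) : ℤ))).toLocal
              (Sum.inr v₃)) 1 →+ ZMod (3 ^ (k' + 1)))
          (κu' : Finset (HeightOneSpectrum (𝓞 ℚ)) →
              galoisCohomology (W.torsionGaloisModule (((3 : ℕ) : ℤ) ^ k' * ((3 : ℕ) : ℤ))) 1),
          KatoKuriharaWitnessAt W k' 0 D' v₃ P κu Λu κu')
    (h₂ : ∀ (W : WeierstrassCurve ℚ) [W.IsElliptic] [W.IsGloballyMinimal],
      (∀ m : ℕ, W.HasSurjectiveModNGaloisRep (3 ^ m : ℕ)) →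
      ∀ (v₃ : HeightOneSpectrum (𝓞 ℚ)), ((3 : ℕ) : 𝓞 ℚ) ∈ v₃.asIdeal →
      ∀ (η : (q : HeightOneSpectrum (𝓞 ℚ)) → (ZMod (Ideal.absNorm q.asIdeal))ˣ),
        (∀ q, Subgroup.zpowers (η q) = ⊤) →
      ∀ {N : ℕ} [NeZero N] (P : ModularParametrizationData W N),
      ∀ (k k' : ℕ) (D : KolyvaginDatum (W.torsionGaloisModule (((3 : ℕ) : ℤ) ^ k * ((3 : ℕ) : ℤ))))
        (D' : KolyvaginDatum (W.torsionGaloisModule (((3 : ℕ) : ℤ) ^ k' * ((3 : ℕ) : ℤ))))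
        (red : (W.torsionGaloisModule (((3 : ℕ) : ℤ) ^ k' * ((3 : ℕ) : ℤ))).toContRepresentation →ⁱL
          (W.torsionGaloisModule (((3 : ℕ) : ℤ) ^ k * ((3 : ℕ) : ℤ))).toContRepresentation),
        D.IsCanonicalTauDatumThreeAtWith W k k η → D'.IsCanonicalTauDatumThreeAtWith W k' k' η →
        k ≤ k' →
        (∀ x : geomTorsion W (((3 : ℕ) : ℤ) ^ k' * ((3 : ℕ) : ℤ)),
          ((red x : geomTorsion W (((3 : ℕ) : ℤ) ^ k * ((3 : ℕ) : ℤ))) : geomPoints W) =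
            (((3 : ℕ) : ℤ) ^ (k' - k)) • (x : geomPoints W)) →
        ∀ (κu : Finset (HeightOneSpectrum (𝓞 ℚ)) →
              galoisCohomology (W.torsionGaloisModule (((3 : ℕ) : ℤ) ^ k' * ((3 : ℕ) : ℤ))) 1)
          (Λu : galoisCohomology ((W.torsionGaloisModule (((3 : ℕ) : ℤ) ^ k' * ((3 : ℕ) : ℤ))).toLocal
              (Sum.inr v₃)) 1 →+ ZMod (3 ^ (k' + 1)))
          (κu' : Finset (HeightOneSpectrum (𝓞 ℚ)) →
              galoisCohomology (W.torsionGaloisModule (((3 : ℕ) : ℤ) ^ k' * ((3 : ℕ) : ℤ))) 1),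
          KatoKuriharaWitnessAt W k' 0 D' v₃ P κu Λu κu' →
        ∃ (κ : Finset (HeightOneSpectrum (𝓞 ℚ)) →
              galoisCohomology (W.torsionGaloisModule (((3 : ℕ) : ℤ) ^ k * ((3 : ℕ) : ℤ))) 1)
          (Λ : galoisCohomology ((W.torsionGaloisModule (((3 : ℕ) : ℤ) ^ k * ((3 : ℕ) : ℤ))).toLocal
              (Sum.inr v₃)) 1 →+ ZMod (3 ^ (k + 1)))
          (κ' : Finset (HeightOneSpectrum (𝓞 ℚ)) →
              galoisCohomology (W.torsionGaloisModule (((3 : ℕ) : ℤ) ^ k * ((3 : ℕ) : ℤ))) 1),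
          KatoKuriharaWitnessAt W k 0 D v₃ P κ Λ κ' ∧
          ∀ d, D'.IsLevel d → D.IsLevel d →
            galoisCohomology.map red 1 (κu d) = κ d ∧ galoisCohomology.map red 1 (κu' d) = κ' d) :
    Summit.BirchSwinnertonDyer.BirchSwinnertonDyer.Theses.KimAtThreeKolyvagin.KatoKuriharaPortThreeShared := by
  intro W _ _ htow hA hc ht v₃ hv₃ η hη N _ P hN hopt hman
  intro k k' D D' red hD hD'
  intro hkk hpin _hA' _hc' hsurj1 _ht' _hv₃' _hman' hper
  obtain ⟨κu, Λu, κu', hWu⟩ := h₁ W htow hA hc ht v₃ hv₃ η hη P hN hopt hman hper k' D' hD'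
  obtain ⟨κ, Λ, κ', hW, hcomp⟩ :=
    h₂ W htow v₃ hv₃ η hη P k k' D D' red hD hD' hkk hpin κu Λu κu' hWu
  exact ⟨κ, Λ, κ', κu, Λu, κu', hW, hWu, hcomp⟩

end Summit.BirchSwinnertonDyer.BirchSwinnertonDyer.Cruxes.KatoKuriharaPortThreeShared.Birth

end
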